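import Summits.BirchSwinnertonDyer.Rank1Residual.AdditivePotMult.ChiEigenSelmerDual
import Summits.BirchSwinnertonDyer.Rank1Residual.Additive.CyclotomicTowerSelmerDualRestriction
import Summits.BirchSwinnertonDyer.Rank1Residual.X2.DualRestriction
import Literature.NumberTheory.EllipticCurves.IwasawaSelmerDualProofs
import Literature.NumberTheory.EllipticCurves.IwasawaAlgebraProofs
import Literature.NumberTheory.EllipticCurves.IwasawaSelmerIsTorsionProofs
import Literature.NumberTheory.EllipticCurves.SelmerInftyTorsionFiniteProofs
import HarnessLib

/-!
# Crux `GordTwoRankZeroOffCaseOne` (route `AdditiveBranchIMC`, item 19357), lane k1-c2x («Skinner–Urban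
# over the quadratic twist field»): the CONTROL AT THE ADDITIVE PRIME, proved — over `K = ℚ(√c)` the
# Iwasawa module of the semistable twist `V = E♭` over `K·ℚ_∞` splits,
# `X(V/K·ℚ_∞) ≅ X(V/ℚ_∞) × X(E/ℚ_∞)` as `Λ`-modules, and `char_Λ X(V/K·ℚ_∞) = char_Λ X(V/ℚ_∞) · char_Λ X(E/ℚ_∞)`

Cell `bsd-addord`, seat `bsd-addord-k1-c2x` (second prover lane on item 19357; director-bsd 2026-08-27:
«Skinner–Urban over the quadratic twist field with explicit control at the additive prime»). HONEST
FRAMING: infrastructure about the TREE'S OWN objects — no curve is asserted to satisfy anything, no named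
fact is minted or consumed, nothing is booked; BSD is not proved by any of this. For `V/ℚ`, a quadratic
field `K = ℚ(θ)`, `θ² = c`, ANY model `W` of the twist `E = V ⊗ χ_K` (`C • V^{(c)} = W`), an odd prime
`p`, a `ℤ_p`-extension datum `κ` of `ℚ` onto on `Gal(ℚ̄/K)` and a topological generator `γ ∈ Gal(ℚ̄/K)`,
it builds from the landed kernel bricks

* additive-p1's transport [C] `twistDescentEquiv : Sel_{p^∞}(E/ℚ_∞) ≃ Sel_{p^∞}(V/K·ℚ_∞)^{(χ_K)}`
  (`TwistDescent`, Greenberg LNM 1716 §5 p. 143 + Dokchitser's sign rule),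
* Greenberg's prime-to-`p` descent `Sel_{p^∞}(V/ℚ_∞) ≃ Sel_{p^∞}(V/K·ℚ_∞)^{Gal}`
  (`selmerInfty_relRestriction_bijective`, `PrimeToPDescent`),
* the `Γ_ℚ`-internal classical dual `X(V/K·ℚ_∞)` (`TowerSelmerDualData V κ K γ`, cell `bsd-potss`) and
  x2's abstract `Λ`-linear restriction of dual data (`X2.DualRestriction.exists_restrict_surjective`),

the `Λ`-LINEAR SURJECTIONS `π₁ : X(V/K·ℚ_∞) ↠ X(V/ℚ_∞)`, `π₂ : X(V/K·ℚ_∞) ↠ X(E/ℚ_∞)` dual to the two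
eigen-inclusions, with `ker π₁ ∩ ker π₂ = 0` and `π₂(ker π₁) = X(E/ℚ_∞)` (the eigenspaces meet in `0`
and span `2·Sel`, `p` odd; characters extend along `Sel^{(χ)} ↪ Sel/Sel^{+}`, `ℚ/ℤ` divisible) — i.e.
the short exact sequence `0 → X(E/ℚ_∞) → X(V/K·ℚ_∞) → X(V/ℚ_∞) → 0` of `Λ`-modules. The sequel
`AdditiveBranchIMCTwistFieldCharIdeal` turns it into the product formula for characteristic ideals.

References: R. Greenberg, LNM 1716 (1999) §1 p. 60, §5 p. 143 [GreenbergLNM1716]; T. Dokchitser,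
*Notes on the parity conjecture* (2013) §4 [Dokchitser2013ParityNotes]; L. Washington, §13.2. -/

set_option autoImplicit false
set_option linter.dupNamespace false

noncomputable section

open scoped Classical

open Literature.NumberTheory.EllipticCurves Literature.NumberTheory.GaloisRepresentations WeierstrassCurve

namespace Summit.BirchSwinnertonDyer.BirchSwinnertonDyer.Theorems.AdditiveBranchIMCTwistField

open Summit.BirchSwinnertonDyer.Rank1Residual.Additive (TowerSelmerDualData towerSelmerInfty
  towerTopSubgroup conjTowerSelmerInfty isLocNil_conjTowerSelmerInfty_sub_one conjH1_mem_towerSelmerInfty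
  exists_pow_smul_subgroupH1_towerTop_eq_zero kappa_surjOn_galRange_of_coprime_finrank
  towerSelmerDualData)
open Summit.BirchSwinnertonDyer.Rank1Residual.AdditivePotMult (chiEigenSelmer mem_chiEigenSelmer_iff
  quadSign quadSign_of_mem quadSign_of_not_mem twistDescentEquiv coe_twistDescentEquiv_conjH1
  coprime_index_galRange eq_zero_of_nsmul_eq_zero_of_coprime selmerInfty_relRestriction_bijective)

/-! ## §1 The quadratic involution on `H¹(Gal(ℚ̄/K·ℚ_∞), V[p^∞])` and the two eigen-subgroups -/

section Involution

variable (V : WeierstrassCurve ℚ) (K : Type) [Field K] [NumberField K]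
  (h2 : Module.finrank ℚ K = 2) {θ : K} {c : ℚ} (hθ : θ ∉ Set.range (algebraMap ℚ K))
  (hc : θ ^ 2 = algebraMap ℚ K c) (p : ℕ) [Fact p.Prime] (κ : ZpExtension ℚ p)
  [(galRange (K := ℚ) K).Normal]

omit [(galRange (K := ℚ) K).Normal] in
include h2 hθ hc in
/-- **An element of `Gal(ℚ̄/ℚ_∞)` off `Gal(ℚ̄/K)`** (`p` odd): `κ` is onto on `Gal(ℚ̄/K)`
(`p ∤ [K:ℚ] = 2`), so a lift `τ` of the non-trivial automorphism of `K` can be corrected inside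
`Gal(ℚ̄/K)` into `ker κ`. [folklore] -/
theorem exists_mem_kerSubgroup_not_mem_galRange (hp2 : p ≠ 2) :
    ∃ σ : Field.absoluteGaloisGroup ℚ, σ ∈ κ.kerSubgroup ∧ σ ∉ galRange (K := ℚ) K := by
  haveI : IsGalois ℚ K := isGalois_of_finrank_eq_two K h2
  set τ := liftToAbsGal (K := ℚ) K (sigmaQ K h2 hθ hc) with hτ
  have hτK : τ ∉ galRange (K := ℚ) K := liftToAbsGal_not_mem K (sigmaQ_ne_one K h2 hθ hc)
  have hcop : Nat.Coprime p (Module.finrank ℚ K) := by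
    rw [h2]; exact (Nat.coprime_primes (Fact.out : p.Prime) Nat.prime_two).mpr hp2
  obtain ⟨g, hgK, hg⟩ := kappa_surjOn_galRange_of_coprime_finrank (κ := κ) K hcop (κ τ)
  refine ⟨g⁻¹ * τ, ?_, fun h ↦ hτK ?_⟩
  · rw [ZpExtension.mem_kerSubgroup, map_mul, map_inv, hg, inv_mul_cancel]
  · simpa using (galRange (K := ℚ) K).mul_mem hgK h

omit [(galRange (K := ℚ) K).Normal] in
include h2 hθ hc in
/-- For `g, σ ∉ Gal(ℚ̄/K)` (index `2`, normal): `g * σ⁻¹ ∈ Gal(ℚ̄/K)`. [folklore] -/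
theorem mul_inv_mem_galRange_of_not_mem {g σ : Field.absoluteGaloisGroup ℚ}
    (hg : g ∉ galRange (K := ℚ) K) (hσ : σ ∉ galRange (K := ℚ) K) :
    g * σ⁻¹ ∈ galRange (K := ℚ) K := by
  haveI : IsGalois ℚ K := isGalois_of_finrank_eq_two K h2
  have hidx := index_galRange K h2 (sigmaQ_ne_one K h2 hθ hc)
  rw [Subgroup.mul_mem_iff_of_index_two hidx]
  exact ⟨fun h ↦ absurd h hg, fun h ↦ absurd ((galRange (K := ℚ) K).inv_mem_iff.mp h) hσ⟩

variable {V K p κ}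

/-- Elements of `ker κ ⊓ Gal(ℚ̄/K)` act trivially on `H¹(ker κ ⊓ Gal(ℚ̄/K), V[p^∞])` (the ambient
group of the tower Selmer group, `towerTopSubgroup κ K = ker κ ⊓ Gal(ℚ̄/K)`). [folklore] -/
theorem conjH1_eq_self_of_mem {g : Field.absoluteGaloisGroup ℚ}
    (hg : g ∈ towerTopSubgroup κ K) (t : V.subgroupH1 p (towerTopSubgroup κ K)) :
    V.conjH1 p _ g t = t := by
  rw [V.conjH1_of_mem_holds p (towerTopSubgroup κ K) hg, AddMonoidHom.id_apply]

include h2 hθ hc in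
/-- **The action of `Gal(ℚ̄/ℚ_∞)` factors through `Gal(K·ℚ_∞/ℚ_∞) = {1, σ}`**: for `g ∈ ker κ` off
`Gal(ℚ̄/K)` and a fixed `σ ∈ ker κ` off `Gal(ℚ̄/K)`, `g_* = σ_*` on `H¹(ker κ ⊓ Gal(ℚ̄/K), V[p^∞])`.
[folklore] -/
theorem conjH1_eq_conjH1_of_not_mem {g σ : Field.absoluteGaloisGroup ℚ} (hg : g ∈ κ.kerSubgroup)
    (hgK : g ∉ galRange (K := ℚ) K) (hσ : σ ∈ κ.kerSubgroup) (hσK : σ ∉ galRange (K := ℚ) K)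
    (t : V.subgroupH1 p (towerTopSubgroup κ K)) :
    V.conjH1 p _ g t = V.conjH1 p _ σ t := by
  have hmem : g * σ⁻¹ ∈ towerTopSubgroup κ K :=
    (Summit.BirchSwinnertonDyer.Rank1Residual.Additive.mem_towerTopSubgroup_iff κ K _).mpr
      ⟨κ.kerSubgroup.mul_mem hg (κ.kerSubgroup.inv_mem hσ),
        mul_inv_mem_galRange_of_not_mem K h2 hθ hc hgK hσK⟩
  conv_lhs => rw [show g = g * σ⁻¹ * σ by rw [inv_mul_cancel_right]]
  rw [V.conjH1_mul_holds p _, AddMonoidHom.comp_apply, conjH1_eq_self_of_mem hmem]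

include h2 hθ hc in
/-- `σ² ` acts trivially (`σ ∈ ker κ` off `Gal(ℚ̄/K)`): `σ_* (σ_* t) = t`. [folklore] -/
theorem conjH1_conjH1_eq_self {σ : Field.absoluteGaloisGroup ℚ} (hσ : σ ∈ κ.kerSubgroup)
    (hσK : σ ∉ galRange (K := ℚ) K) (t : V.subgroupH1 p (towerTopSubgroup κ K)) :
    V.conjH1 p _ σ (V.conjH1 p _ σ t) = t := by
  have hmem : σ * σ ∈ towerTopSubgroup κ K := by
    refine (Summit.BirchSwinnertonDyer.Rank1Residual.Additive.mem_towerTopSubgroup_iff κ K _).mpr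
      ⟨κ.kerSubgroup.mul_mem hσ hσ, ?_⟩
    have h := mul_inv_mem_galRange_of_not_mem K h2 hθ hc hσK
      (show σ⁻¹ ∉ galRange (K := ℚ) K from fun h ↦ hσK ((galRange (K := ℚ) K).inv_mem_iff.mp h))
    rwa [inv_inv] at h
  rw [← AddMonoidHom.comp_apply, ← V.conjH1_mul_holds p _, conjH1_eq_self_of_mem hmem]

omit [(galRange (K := ℚ) K).Normal] in
/-- Every class of `H¹(ker κ ⊓ Gal(ℚ̄/K), V[p^∞])` is killed by a power of `p`. [folklore] -/
theorem exists_pow_nsmul_eq_zero (t : V.subgroupH1 p (towerTopSubgroup κ K)) :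
    ∃ k : ℕ, p ^ k • t = 0 :=
  exists_pow_smul_subgroupH1_towerTop_eq_zero V κ K t

omit [(galRange (K := ℚ) K).Normal] in
/-- In `H¹(ker κ ⊓ Gal(ℚ̄/K), V[p^∞])` (`p` odd), `2 • t = 0` forces `t = 0`. [folklore] -/
theorem eq_zero_of_two_nsmul_eq_zero (hp2 : p ≠ 2)
    {t : V.subgroupH1 p (towerTopSubgroup κ K)} (ht : 2 • t = 0) : t = 0 :=
  eq_zero_of_nsmul_eq_zero_of_coprime (p := p) exists_pow_nsmul_eq_zero
    ((Nat.coprime_primes Nat.prime_two (Fact.out : p.Prime)).mpr hp2.symm) ht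

/-- In an abelian group, an element killed by two coprime naturals is `0` (its order divides
both). [folklore] -/
theorem eq_zero_of_nsmul_eq_zero_of_nsmul_eq_zero {A : Type*} [AddCommGroup A] {a : A} {m n : ℕ}
    (hm : m • a = 0) (hn : n • a = 0) (h : m.Coprime n) : a = 0 := by
  have h1 : addOrderOf a ∣ Nat.gcd m n :=
    Nat.dvd_gcd (addOrderOf_dvd_of_nsmul_eq_zero hm) (addOrderOf_dvd_of_nsmul_eq_zero hn)
  rw [Nat.Coprime.gcd_eq_one h, Nat.dvd_one] at h1
  exact AddMonoid.addOrderOf_eq_one_iff.mp h1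

end Involution

/-! ## §2 The two eigen-inclusions `Sel_{p^∞}(V/ℚ_∞) ↪ Sel_{p^∞}(V/K·ℚ_∞) ↩ Sel_{p^∞}(E/ℚ_∞)` -/
section Inclusions

variable (V : WeierstrassCurve ℚ) [V.IsElliptic] (K : Type) [Field K] [NumberField K]
  (h2 : Module.finrank ℚ K = 2) {θ : K} {c : ℚ} (hθ : θ ∉ Set.range (algebraMap ℚ K))
  (hc : θ ^ 2 = algebraMap ℚ K c) (p : ℕ) [Fact p.Prime] (κ : ZpExtension ℚ p)
  [(galRange (K := ℚ) K).Normal] [(V.quadraticTwist c).IsElliptic]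
  {W : WeierstrassCurve ℚ} {C : VariableChange ℚ} (hCW : C • V.quadraticTwist c = W)

omit [(V.quadraticTwist c).IsElliptic] in
include h2 hθ hc in
/-- **The `+`-inclusion `ι₊ : Sel_{p^∞}(V/ℚ_∞) ↪ Sel_{p^∞}(V/K·ℚ_∞)`** (restriction; Greenberg's
prime-to-`p` descent, `p` odd): an injective additive map whose underlying class is `res s`, whose image
is EXACTLY the `Gal(ℚ̄/ℚ_∞)`-invariant Selmer classes, and which intertwines `conj_g` for every `g ∈ Γ_ℚ`.
[cite: GreenbergLNM1716, §5 p. 143] -/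
theorem exists_plusIncl (hp2 : p ≠ 2) :
    ∃ ι : V.selmerInfty κ →+ towerSelmerInfty V κ K,
      Function.Injective ι ∧
      (∀ s, ((ι s : towerSelmerInfty V κ K) : V.subgroupH1 p (towerTopSubgroup κ K)) =
        V.resOfLe p (inf_le_left : κ.kerSubgroup ⊓ galRange (K := ℚ) K ≤ κ.kerSubgroup) s) ∧
      (∀ t : towerSelmerInfty V κ K, t ∈ Set.range ι ↔
        ∀ g : κ.kerSubgroup, V.conjH1 p _ (g : Field.absoluteGaloisGroup ℚ)
          (t : V.subgroupH1 p (towerTopSubgroup κ K)) = t) ∧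
      (∀ (g : Field.absoluteGaloisGroup ℚ) (s : V.selmerInfty κ),
        ((ι (V.conjSelmerInfty κ g s) : towerSelmerInfty V κ K) :
            V.subgroupH1 p (towerTopSubgroup κ K)) =
          V.conjH1 p _ g ((ι s : towerSelmerInfty V κ K) : V.subgroupH1 p (towerTopSubgroup κ K))) := by
  have hle : κ.kerSubgroup ⊓ galRange (K := ℚ) K ≤ κ.kerSubgroup := inf_le_left
  have hbij := selmerInfty_relRestriction_bijective V p κ (U := galRange (K := ℚ) K)
    (isOpen_galRange K) (coprime_index_galRange K h2 hθ hc p hp2)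
  have hsub : V.selmerGroupOverRelInvariants p (κ.kerSubgroup ⊓ galRange (K := ℚ) K) κ.kerSubgroup ≤
      towerSelmerInfty V κ K := fun t ht ↦ ((V.mem_selmerGroupOverRelInvariants_iff p _).mp ht).1
  let ι : V.selmerInfty κ →+ towerSelmerInfty V κ K :=
    (AddSubgroup.inclusion hsub).comp (V.selmerRelRestriction p hle)
  have hι : ∀ s, ((ι s : towerSelmerInfty V κ K) : V.subgroupH1 p (towerTopSubgroup κ K)) =
      V.resOfLe p hle s := fun s ↦ rfl
  refine ⟨ι, fun s s' hss' ↦ hbij.1 (Subtype.ext ?_), hι, fun t ↦ ⟨?_, fun ht ↦ ?_⟩, fun g s ↦ ?_⟩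
  · exact congrArg (fun u : towerSelmerInfty V κ K ↦ (u : V.subgroupH1 p (towerTopSubgroup κ K))) hss'
  · rintro ⟨s, rfl⟩ g
    exact ((V.mem_selmerGroupOverRelInvariants_iff p _).mp (V.selmerRelRestriction p hle s).2).2 g
  · have htmem : (t : V.subgroupH1 p (towerTopSubgroup κ K)) ∈
        V.selmerGroupOverRelInvariants p (κ.kerSubgroup ⊓ galRange (K := ℚ) K) κ.kerSubgroup :=
      (V.mem_selmerGroupOverRelInvariants_iff p _).mpr ⟨t.2, ht⟩
    obtain ⟨s, hs⟩ := hbij.2 ⟨_, htmem⟩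
    refine ⟨s, Subtype.ext ?_⟩
    rw [hι]
    exact congrArg
      (fun u : V.selmerGroupOverRelInvariants p (κ.kerSubgroup ⊓ galRange (K := ℚ) K) κ.kerSubgroup ↦
        (u : V.subgroupH1 p (κ.kerSubgroup ⊓ galRange (K := ℚ) K))) hs
  · rw [hι, hι, coe_conjSelmerInfty_apply]
    exact congrArg (fun f ↦ f (s : V.subgroupH1 p κ.kerSubgroup))
      (resOfLe_comp_conjH1_holds (M := geomPrimaryTorsion V p) hle g)

omit [V.IsElliptic] in
include h2 hθ hc hCW in
/-- **The `χ`-inclusion `ι_χ : Sel_{p^∞}(E/ℚ_∞) ↪ Sel_{p^∞}(V/K·ℚ_∞)`** (additive-p1's transport [C],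
any model `C • V^{(c)} = W`, `p` odd): injective, image EXACTLY the `χ_K`-eigen classes
(`chiEigenSelmer`), and intertwining `conj_g` up to the sign `χ_K(g)` for every `g ∈ Γ_ℚ`.
[cite: GreenbergLNM1716, §5 p. 143] [cite: Dokchitser2013ParityNotes, §4] -/
theorem exists_chiIncl (hp2 : p ≠ 2) :
    ∃ ι : W.selmerInfty κ →+ towerSelmerInfty V κ K,
      Function.Injective ι ∧
      (∀ s, ((ι s : towerSelmerInfty V κ K) : V.subgroupH1 p (towerTopSubgroup κ K)) =
        ((twistDescentEquiv V K h2 hθ hc p κ hCW hp2 s : chiEigenSelmer V K p κ) :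
          V.subgroupH1 p (κ.kerSubgroup ⊓ galRange (K := ℚ) K))) ∧
      (∀ t : towerSelmerInfty V κ K, t ∈ Set.range ι ↔
        ∀ g : κ.kerSubgroup, V.conjH1 p _ (g : Field.absoluteGaloisGroup ℚ)
          (t : V.subgroupH1 p (towerTopSubgroup κ K)) = quadSign K g • t) ∧
      (∀ (g : Field.absoluteGaloisGroup ℚ) (s : W.selmerInfty κ),
        ((ι (W.conjSelmerInfty κ g s) : towerSelmerInfty V κ K) :
            V.subgroupH1 p (towerTopSubgroup κ K)) =
          quadSign K g •
            V.conjH1 p _ g ((ι s : towerSelmerInfty V κ K) : V.subgroupH1 p (towerTopSubgroup κ K))) := by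
  let Θ := twistDescentEquiv V K h2 hθ hc p κ hCW hp2
  have hsub : chiEigenSelmer V K p κ ≤ towerSelmerInfty V κ K := fun t ht ↦ ht.1
  let ι : W.selmerInfty κ →+ towerSelmerInfty V κ K :=
    (AddSubgroup.inclusion hsub).comp Θ.toAddMonoidHom
  have hι : ∀ s, ((ι s : towerSelmerInfty V κ K) : V.subgroupH1 p (towerTopSubgroup κ K)) =
      ((Θ s : chiEigenSelmer V K p κ) : V.subgroupH1 p (κ.kerSubgroup ⊓ galRange (K := ℚ) K)) :=
    fun s ↦ rfl
  refine ⟨ι, fun s s' hss' ↦ Θ.injective (Subtype.ext ?_), hι, fun t ↦ ⟨?_, fun ht ↦ ?_⟩,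
    fun g s ↦ ?_⟩
  · exact congrArg (fun u : towerSelmerInfty V κ K ↦ (u : V.subgroupH1 p (towerTopSubgroup κ K))) hss'
  · rintro ⟨s, rfl⟩ g
    exact (Θ s).2.2 g
  · have htmem : (t : V.subgroupH1 p (towerTopSubgroup κ K)) ∈ chiEigenSelmer V K p κ := ⟨t.2, ht⟩
    refine ⟨Θ.symm ⟨_, htmem⟩, Subtype.ext ?_⟩
    rw [hι, AddEquiv.apply_symm_apply]
  · rw [hι, hι]
    exact coe_twistDescentEquiv_conjH1 V K h2 hθ hc p κ hCW hp2 g s _ (coe_conjSelmerInfty_apply W κ g s)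

omit [V.IsElliptic] [(V.quadraticTwist c).IsElliptic] in
include h2 hθ hc in
/-- **The two eigen-subgroups meet in `0` and span `2·Sel`** (`p` odd): for `σ ∈ ker κ` off
`Gal(ℚ̄/K)` and a class `t`, `t + σ_* t` is `Gal(ℚ̄/ℚ_∞)`-invariant, `t − σ_* t` is `χ_K`-variant,
and a class that is both invariant and `χ_K`-variant is `0`. [folklore] -/
theorem eigen_decomposition (hp2 : p ≠ 2) {σ : Field.absoluteGaloisGroup ℚ} (hσ : σ ∈ κ.kerSubgroup)
    (hσK : σ ∉ galRange (K := ℚ) K) (t : V.subgroupH1 p (towerTopSubgroup κ K)) :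
    (∀ g : κ.kerSubgroup, V.conjH1 p _ (g : Field.absoluteGaloisGroup ℚ) (t + V.conjH1 p _ σ t) =
        t + V.conjH1 p _ σ t) ∧
    (∀ g : κ.kerSubgroup, V.conjH1 p _ (g : Field.absoluteGaloisGroup ℚ) (t - V.conjH1 p _ σ t) =
        quadSign K g • (t - V.conjH1 p _ σ t)) ∧
    ((∀ g : κ.kerSubgroup, V.conjH1 p _ (g : Field.absoluteGaloisGroup ℚ) t = t) →
      (∀ g : κ.kerSubgroup, V.conjH1 p _ (g : Field.absoluteGaloisGroup ℚ) t = quadSign K g • t) →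
        t = 0) := by
  have hσσ := conjH1_conjH1_eq_self (V := V) (K := K) h2 hθ hc (p := p) (κ := κ) hσ hσK
  refine ⟨fun g ↦ ?_, fun g ↦ ?_, fun hinv hvar ↦ ?_⟩
  · by_cases hgK : (g : Field.absoluteGaloisGroup ℚ) ∈ galRange (K := ℚ) K
    · exact conjH1_eq_self_of_mem ⟨g.2, hgK⟩ _
    · rw [conjH1_eq_conjH1_of_not_mem (V := V) (K := K) h2 hθ hc g.2 hgK hσ hσK, map_add, hσσ,
        add_comm]
  · by_cases hgK : (g : Field.absoluteGaloisGroup ℚ) ∈ galRange (K := ℚ) K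
    · rw [conjH1_eq_self_of_mem ⟨g.2, hgK⟩ _, quadSign_of_mem K hgK, one_smul]
    · rw [conjH1_eq_conjH1_of_not_mem (V := V) (K := K) h2 hθ hc g.2 hgK hσ hσK, map_sub, hσσ,
        quadSign_of_not_mem K hgK, neg_one_zsmul, neg_sub]
  · have h1 := hinv ⟨σ, hσ⟩
    have h2' := hvar ⟨σ, hσ⟩
    rw [quadSign_of_not_mem K hσK, neg_one_zsmul] at h2'
    refine eq_zero_of_two_nsmul_eq_zero (K := K) hp2 ?_
    rw [two_nsmul]
    nth_rw 1 [← h1]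
    rw [h2']
    exact neg_add_cancel t

end Inclusions

/-! ## §3 The dual side: `X(V/K·ℚ_∞) ↠ X(V/ℚ_∞)`, `X(V/K·ℚ_∞) ↠ X(E/ℚ_∞)`, `ker π₁ ≅ X(E/ℚ_∞)` -/
section Dual

variable (V : WeierstrassCurve ℚ) [V.IsElliptic] (K : Type) [Field K] [NumberField K]
  (h2 : Module.finrank ℚ K = 2) {θ : K} {c : ℚ} (hθ : θ ∉ Set.range (algebraMap ℚ K))
  (hc : θ ^ 2 = algebraMap ℚ K c) (p : ℕ) [Fact p.Prime] (κ : ZpExtension ℚ p)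
  [(galRange (K := ℚ) K).Normal] [(V.quadraticTwist c).IsElliptic]
  {W : WeierstrassCurve ℚ} {C : VariableChange ℚ} (hCW : C • V.quadraticTwist c = W)
  {γ : Field.absoluteGaloisGroup ℚ} (hγ : κ.IsTopGenerator γ) (hγK : γ ∈ galRange (K := ℚ) K)

omit [V.IsElliptic] [(galRange (K := ℚ) K).Normal] [(V.quadraticTwist c).IsElliptic] in
include h2 in
/-- `κ` is onto on `Gal(ℚ̄/K)` (`p ∤ 2 = [K : ℚ]`). [folklore] -/
theorem kappa_surjOn_galRange (hp2 : p ≠ 2) (x : Multiplicative ℤ_[p]) :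
    ∃ g ∈ galRange (K := ℚ) K, κ g = x := by
  haveI : IsGalois ℚ K := isGalois_of_finrank_eq_two K h2
  have hcop : Nat.Coprime p (Module.finrank ℚ K) := by
    rw [h2]; exact (Nat.coprime_primes (Fact.out : p.Prime) Nat.prime_two).mpr hp2
  exact kappa_surjOn_galRange_of_coprime_finrank (κ := κ) K hcop x

include h2 hθ hc hCW hγ hγK in
/-- **The `Λ`-linear structure of the splitting.** For a classical tower datum `D_K` of
`X(V/K·ℚ_∞)`, a datum `D_V` of `X(V/ℚ_∞)` and a datum `D` of `X(E/ℚ_∞)` at the same generator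
`γ ∈ Gal(ℚ̄/K)` (`p` odd): there are `Λ`-LINEAR SURJECTIONS `π₁ : X(V/K·ℚ_∞) ↠ X(V/ℚ_∞)` and
`π₂ : X(V/K·ℚ_∞) ↠ X(E/ℚ_∞)` (dual to `ι₊`, `ι_χ` of §2: x2's `exists_restrict_surjective`) with
`ker π₁ ∩ ker π₂ = 0` (a character vanishing on both eigen-subgroups vanishes on `2·Sel = Sel`) and
`π₂` onto already on `ker π₁` (characters of `Sel_{p^∞}(E/ℚ_∞)` extend along the injection
`Sel^{(χ)} ↪ Sel/Sel^{+}`, `ℚ/ℤ` divisible). [cite: GreenbergLNM1716, §1 p. 60, §5 p. 143] -/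
theorem exists_dual_projections (hp2 : p ≠ 2) (D_K : TowerSelmerDualData V κ K γ)
    (D_V : V.SelmerDualData κ γ) (D : W.SelmerDualData κ γ) :
    ∃ (π₁ : D_K.X →ₗ[IwasawaAlgebra p] D_V.X) (π₂ : D_K.X →ₗ[IwasawaAlgebra p] D.X),
      Function.Surjective π₁ ∧ Function.Surjective π₂ ∧
      (∀ x, π₁ x = 0 → π₂ x = 0 → x = 0) ∧
      (∀ y : D.X, ∃ x, π₁ x = 0 ∧ π₂ x = y) := by
  obtain ⟨σ, hσ, hσK⟩ := exists_mem_kerSubgroup_not_mem_galRange K h2 hθ hc p κ hp2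
  obtain ⟨ι₁, hι₁inj, -, hι₁range, hι₁conj⟩ := exists_plusIncl V K h2 hθ hc p κ hp2
  obtain ⟨ι₂, hι₂inj, -, hι₂range, hι₂conj⟩ := exists_chiIncl V K h2 hθ hc p κ hCW hp2
  have hK₀ := kappa_surjOn_galRange K h2 p κ hp2
  have hlocK := isLocNil_conjTowerSelmerInfty_sub_one V κ K hK₀ hγ hγK
  -- the two Λ-linear restrictions (x2's abstract tool)
  obtain ⟨π₁, hπ₁surj, hπ₁, hπ₁ker⟩ :=
    Summit.BirchSwinnertonDyer.Rank1Residual.X2.DualRestriction.exists_restrict_surjective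
    (conjTowerSelmerInfty V κ K γ) (V.conjSelmerInfty κ γ) hlocK
    (V.isLocNil_conjSelmerInfty_sub_one κ hγ) D_K.toDual D_V.toDual D_K.bijective D_V.bijective
    (fun x s ↦ by rw [D_K.toDual_T_smul]; rfl) D_K.toDual_C_smul
    (fun x s ↦ by rw [D_V.toDual_T_smul]; rfl) D_V.toDual_C_smul ι₁
    (fun s ↦ Subtype.ext (by
      rw [Summit.BirchSwinnertonDyer.Rank1Residual.Additive.coe_conjTowerSelmerInfty_apply, hι₁conj]))
    hι₁inj
  obtain ⟨π₂, hπ₂surj, hπ₂, hπ₂ker⟩ :=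
    Summit.BirchSwinnertonDyer.Rank1Residual.X2.DualRestriction.exists_restrict_surjective
    (conjTowerSelmerInfty V κ K γ) (W.conjSelmerInfty κ γ) hlocK
    (W.isLocNil_conjSelmerInfty_sub_one κ hγ) D_K.toDual D.toDual D_K.bijective D.bijective
    (fun x s ↦ by rw [D_K.toDual_T_smul]; rfl) D_K.toDual_C_smul
    (fun x s ↦ by rw [D.toDual_T_smul]; rfl) D.toDual_C_smul ι₂
    (fun s ↦ Subtype.ext (by
      rw [Summit.BirchSwinnertonDyer.Rank1Residual.Additive.coe_conjTowerSelmerInfty_apply, hι₂conj,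
        quadSign_of_mem K hγK, one_smul]))
    hι₂inj
  refine ⟨π₁, π₂, hπ₁surj, hπ₂surj, fun x hx₁ hx₂ ↦ ?_, fun y ↦ ?_⟩
  · -- a character vanishing on both eigen-subgroups vanishes on `2·Sel`, hence on `Sel`
    apply D_K.bijective.1
    rw [map_zero]
    ext t
    have h₁ : (D_K.toDual x).comp ι₁ = 0 := (hπ₁ker x).mp hx₁
    have h₂ : (D_K.toDual x).comp ι₂ = 0 := (hπ₂ker x).mp hx₂
    obtain ⟨hinv, hvar, -⟩ := eigen_decomposition V K h2 hθ hc p κ hp2 hσ hσK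
      (t : V.subgroupH1 p (towerTopSubgroup κ K))
    let tσ : towerSelmerInfty V κ K := ⟨V.conjH1 p _ σ (t : V.subgroupH1 p (towerTopSubgroup κ K)),
      conjH1_mem_towerSelmerInfty V κ K σ t.2⟩
    obtain ⟨s₁, hs₁⟩ := (hι₁range (t + tσ)).mpr hinv
    obtain ⟨s₂, hs₂⟩ := (hι₂range (t - tσ)).mpr hvar
    have e₁ : D_K.toDual x (t + tσ) = 0 := by
      rw [← hs₁]; exact DFunLike.congr_fun h₁ s₁
    have e₂ : D_K.toDual x (t - tσ) = 0 := by
      rw [← hs₂]; exact DFunLike.congr_fun h₂ s₂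
    have h2t : (2 : ℕ) • D_K.toDual x t = 0 := by
      rw [← map_nsmul, two_nsmul, show t + t = (t + tσ) + (t - tσ) by abel, map_add, e₁, e₂, add_zero]
    obtain ⟨k, hk⟩ := exists_pow_nsmul_eq_zero (K := K) (t : V.subgroupH1 p (towerTopSubgroup κ K))
    have hkt : (p ^ k : ℕ) • D_K.toDual x t = 0 := by
      rw [← map_nsmul]
      have : (p ^ k : ℕ) • t = 0 := Subtype.ext (by rw [AddSubgroupClass.coe_nsmul]; exact hk)
      rw [this, map_zero]
    rw [AddMonoidHom.zero_apply]
    exact eq_zero_of_nsmul_eq_zero_of_nsmul_eq_zero h2t hkt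
      (Nat.Coprime.pow_right k ((Nat.coprime_primes Nat.prime_two (Fact.out : p.Prime)).mpr hp2.symm))
  · -- extend the character `D.toDual y` of `Sel_{p^∞}(E/ℚ_∞)` along `Sel^{(χ)} ↪ Sel / Sel^{+}`
    let N : AddSubgroup (towerSelmerInfty V κ K) := ι₁.range
    let j : W.selmerInfty κ →+ towerSelmerInfty V κ K ⧸ N := (QuotientAddGroup.mk' N).comp ι₂
    have hj : Function.Injective j := by
      intro s s' hss'
      rw [← sub_eq_zero] at hss' ⊢
      rw [← map_sub] at hss'
      have hmem : ι₂ (s - s') ∈ N := by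
        rwa [AddMonoidHom.comp_apply, QuotientAddGroup.mk'_apply, QuotientAddGroup.eq_zero_iff] at hss'
      obtain ⟨s₁, hs₁⟩ := AddMonoidHom.mem_range.mp hmem
      have hinv := (hι₁range (ι₂ (s - s'))).mp ⟨s₁, hs₁⟩
      have hvar := (hι₂range (ι₂ (s - s'))).mp ⟨s - s', rfl⟩
      obtain ⟨-, -, hzero⟩ := eigen_decomposition V K h2 hθ hc p κ hp2 hσ hσK
        ((ι₂ (s - s') : towerSelmerInfty V κ K) : V.subgroupH1 p (towerTopSubgroup κ K))
      have h0 : ι₂ (s - s') = 0 := Subtype.ext (hzero hinv hvar)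
      exact hι₂inj (by rw [h0, map_zero])
    obtain ⟨Φ, hΦ⟩ := CharacterModule.dual_surjective_of_injective j.toIntLinearMap hj (D.toDual y)
    obtain ⟨x, hx⟩ := D_K.bijective.2 (Φ.comp (QuotientAddGroup.mk' N))
    refine ⟨x, (hπ₁ker x).mpr ?_, D.bijective.1 ?_⟩
    · ext s₁
      rw [AddMonoidHom.comp_apply, hx, AddMonoidHom.comp_apply, AddMonoidHom.zero_apply,
        QuotientAddGroup.mk'_apply, (QuotientAddGroup.eq_zero_iff _).mpr (AddMonoidHom.mem_range.mpr ⟨s₁, rfl⟩),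
        map_zero]
    · rw [hπ₂, hx, ← hΦ]
      rfl

end Dual

end Summit.BirchSwinnertonDyer.BirchSwinnertonDyer.Theorems.AdditiveBranchIMCTwistField

end
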